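import Summits.ValiantsHypothesis.ValiantsHypothesis.Theorems.KPlusLogSqLawTropicalBLongRangeAtoms

/-!
# Route «KPlusLogSqLaw», crux `TropicalB` (stmt-ValiantsHypothesis-19771) — THE NESTED-BLOCK LAW (orbit count): between two terms of a
# counting-tight chain at distance `D` at most `D` orbits change; in any chain, `r` nested separating blocks cost `r` achievable slopes in the gap

HONEST FRAMING.  Part 5 of the long-range atom laws (seat val-sym-trop-p1 g21, cell `pub-symmetroid`, 2026-08-28; `--supports
stmt-ValiantsHypothesis-19771 --as helper`).  STRUCTURE laws valid for every dominance design at every format (no hypothesis on exponents, valuations,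
support or signs).  They generalise the ATOM BUDGET (…TropicalBAtomBudget, g13: a composite step costs one unvisited achievable slope; counting-tight
chains are atomic) from «composite or not» to «HOW MANY independent blocks»: nothing here bounds `TropicalB` in its window or bears on `WeakLifting`,
DoorA26 / DoorA34, `MatrixDescartes` (stmt-ValiantsHypothesis-18050) or VP ≠ VNP.

THE LAWS.  `p` dominant at `θ₁`, `q` at `θ₂ > θ₁`; a NESTED SEPARATING FAMILY for `(p, q)` is a chain `T₀ ⊂ T₁ ⊂ … ⊂ T_{r−1}` of column sets invariant
under `σ_p⁻¹σ_q`, each separating the changes (the terms differ on `T_i` and off `T_i`), each enlargement `T_j ⊋ T_i` containing a changed column outside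
`T_i`.  (Canonical instance: if the two terms differ on `t` orbits of `σ_p⁻¹σ_q`, the unions of the first `1, 2, …, t−1` orbits form such a family with
`r = t − 1`.)
* `hybridSlope_strictMono` — the hybrid slopes `Σ_{T_i} d(λ_q) + Σ_{T_iᶜ} d(λ_p)` strictly increase with `i` (cyclewise monotonicity of the tree on the
  invariant differences `T_j \ T_i`).
* `nested_blocks_le_card_gap` — **ORBIT BUDGET (one pair)**: the open slope gap `(slope p, slope q)` contains at least `r` ACHIEVABLE slopes (the `r` hybrids
  are present terms with distinct slopes strictly inside): `r ≤ #{s ∈ slopeSet m d : slope p < s < slope q}`.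
* `nested_blocks_le_dist` — **ORBIT COUNT LAW**: along a chain EXHAUSTING THE SLOPE BUDGET (`#slopeSet m d ≤ n+1`, e.g. counting-tight), a nested
  separating family for `(p_k, p_k')` has `r ≤ k' − k − 1` members — between two terms of a counting-tight chain at distance `D` at most `D` orbits
  change (distance 1: atomic steps; distance 2: at most two orbits, cf. the AP law of part 1); census form `nested_blocks_le_dist_of_multichoose_le`.
[exchange argument + pigeonhole; the packaging is this cell's, no citation exists]
-/

set_option linter.dupNamespace false
set_option autoImplicit false

namespace Summit.ValiantsHypothesis.ValiantsHypothesis.Theorems.KPlusLogSqLaw.LongRangeAtom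

open Summit.ValiantsHypothesis.ValiantsHypothesis.Theorems.MatrixDescartes.Negative
open Summit.ValiantsHypothesis.ValiantsHypothesis.Theorems.LacunarySymmetroidMatrixDescartes
open Summit.ValiantsHypothesis.ValiantsHypothesis.Theorems.LacunarySymmetroidMatrixDescartes.TropicalCensus
open Summit.ValiantsHypothesis.ValiantsHypothesis.Theorems.KPlusLogSqLaw.Sumset
open Summit.ValiantsHypothesis.ValiantsHypothesis.Theorems.KPlusLogSqLaw.AtomBudget
open scoped BigOperators
open Finset

variable {m K : ℕ}

/-! ## 1. Hybrid slopes along a nested separating family strictly increase -/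

/-- the HYBRID SLOPE of the pair `(p, q)` along the block `T`: `q`'s classes on `T`, `p`'s off `T`. -/
theorem hybridSlope_def (d : Fin K → ℕ) (p q : Equiv.Perm (Fin m) × (Fin m → Fin K)) (T : Finset (Fin m)) :
    (∑ b ∈ T, (d (q.2 b) : ℤ) + ∑ b ∈ Tᶜ, (d (p.2 b) : ℤ)) =
      TropicalCensus.slope d p + (∑ b ∈ T, (d (q.2 b) : ℤ) - ∑ b ∈ T, (d (p.2 b) : ℤ)) := by
  rw [slope_eq_sum_add_sum_compl d p T]; ring

/-- the difference of two invariant column sets is invariant. [folklore] -/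
theorem sdiff_invariant (π : Equiv.Perm (Fin m)) (T T' : Finset (Fin m)) (hT : ∀ b, π b ∈ T ↔ b ∈ T) (hT' : ∀ b, π b ∈ T' ↔ b ∈ T') :
    ∀ b, π b ∈ T' \ T ↔ b ∈ T' \ T := fun b => by
  rw [Finset.mem_sdiff, Finset.mem_sdiff, hT b, hT' b]

/-- **hybrid slopes increase along nested invariant blocks.**  If `p` is dominant at `θ₁`, `q` at `θ₂ > θ₁`, `T ⊆ T'` are invariant under
`σ_p⁻¹σ_q` and the terms differ at some column of `T' \ T`, then the hybrid slope along `T` is smaller than along `T'`. [this cell] -/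
theorem hybridSlope_lt_of_subset (d : Fin K → ℕ) (v ε : Fin m → Fin m → Fin K → ℤ) {θ₁ θ₂ : ℤ} (hθ : θ₁ < θ₂)
    {p q : Equiv.Perm (Fin m) × (Fin m → Fin K)} (hp : IsDominant d v ε θ₁ p) (hq : IsDominant d v ε θ₂ q)
    {T T' : Finset (Fin m)} (hTT' : T ⊆ T') (hT : ∀ b, (p.1⁻¹ * q.1) b ∈ T ↔ b ∈ T) (hT' : ∀ b, (p.1⁻¹ * q.1) b ∈ T' ↔ b ∈ T')
    (hch : ∃ b ∈ T' \ T, p.1 b ≠ q.1 b ∨ p.2 b ≠ q.2 b) :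
    (∑ b ∈ T, (d (q.2 b) : ℤ) + ∑ b ∈ Tᶜ, (d (p.2 b) : ℤ)) < ∑ b ∈ T', (d (q.2 b) : ℤ) + ∑ b ∈ T'ᶜ, (d (p.2 b) : ℤ) := by
  classical
  obtain ⟨σ₁, l₁⟩ := p
  obtain ⟨σ₂, l₂⟩ := q
  have hlt := sum_d_lt_of_isDominant_invariant d v ε hθ hp hq (T' \ T) (sdiff_invariant _ T T' hT hT') hch
  -- split `T' = T ∪ (T' \ T)` and `Tᶜ = (T' \ T) ∪ T'ᶜ`
  have e1 : ∑ b ∈ T', (d (l₂ b) : ℤ) = ∑ b ∈ T, (d (l₂ b) : ℤ) + ∑ b ∈ T' \ T, (d (l₂ b) : ℤ) := by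
    rw [← Finset.sum_union (Finset.disjoint_sdiff), Finset.union_sdiff_of_subset hTT']
  have e2 : ∑ b ∈ Tᶜ, (d (l₁ b) : ℤ) = ∑ b ∈ T' \ T, (d (l₁ b) : ℤ) + ∑ b ∈ T'ᶜ, (d (l₁ b) : ℤ) := by
    rw [← Finset.sum_union]
    · congr 1
      ext b
      simp only [Finset.mem_compl, Finset.mem_union, Finset.mem_sdiff]
      constructor
      · intro hb
        by_cases hb' : b ∈ T'
        · exact Or.inl ⟨hb', hb⟩
        · exact Or.inr hb'
      · rintro (⟨-, hb⟩ | hb)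
        · exact hb
        · exact fun h => hb (hTT' h)
    · exact Finset.disjoint_left.mpr fun b hb hb' => (Finset.mem_compl.mp hb') (Finset.mem_sdiff.mp hb).1
  simp only at e1 e2 hlt ⊢
  rw [e1, e2]
  linarith

section Chain

variable (d : Fin K → ℕ) (v ε : Fin m → Fin m → Fin K → ℤ) {n : ℕ}
  (θ : Fin (n + 1) → ℤ) (p : Fin (n + 1) → Equiv.Perm (Fin m) × (Fin m → Fin K))

/-! ## 2. The orbit budget for one pair (any chain) -/

/-- **ORBIT BUDGET (one pair).**  Let `p_k ≺ p_k'` be terms of a dominant chain and `T₀ ⊂ … ⊂ T_{r−1}` a nested separating family of invariant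
blocks of `σ_k⁻¹σ_k'` (each separates the changes; each enlargement contains a new changed column).  Then the open slope gap `(slope p_k, slope p_k')`
contains at least `r` achievable slopes. [this cell] -/
theorem nested_blocks_le_card_gap (hθ : StrictMono θ) (hdom : ∀ k, IsDominant d v ε (θ k) (p k))
    {k k' : Fin (n + 1)} (hkk' : k < k') {r : ℕ} (T : Fin r → Finset (Fin m))
    (hT : ∀ i, ∀ b, ((p k).1⁻¹ * (p k').1) b ∈ T i ↔ b ∈ T i)
    (hin : ∀ i, ∃ b ∈ T i, (p k).1 b ≠ (p k').1 b ∨ (p k).2 b ≠ (p k').2 b)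
    (hout : ∀ i, ∃ b ∉ T i, (p k).1 b ≠ (p k').1 b ∨ (p k).2 b ≠ (p k').2 b)
    (hnest : ∀ i j : Fin r, i < j → T i ⊆ T j ∧ ∃ b ∈ T j \ T i, (p k).1 b ≠ (p k').1 b ∨ (p k).2 b ≠ (p k').2 b) :
    r ≤ ((slopeSet m d).filter fun s => TropicalCensus.slope d (p k) < s ∧ s < TropicalCensus.slope d (p k')).card := by
  classical
  -- hybrid slope of block `i`
  set h : Fin r → ℤ := fun i => ∑ b ∈ T i, (d ((p k').2 b) : ℤ) + ∑ b ∈ (T i)ᶜ, (d ((p k).2 b) : ℤ) with hh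
  have hmono : StrictMono h := by
    intro i j hij
    obtain ⟨hsub, hch⟩ := hnest i j hij
    exact hybridSlope_lt_of_subset d v ε (hθ hkk') (hdom k) (hdom k') hsub (hT i) (hT j) hch
  have hmem : ∀ i, h i ∈ (slopeSet m d).filter fun s => TropicalCensus.slope d (p k) < s ∧ s < TropicalCensus.slope d (p k') := by
    intro i
    obtain ⟨x, hx, hxT, hxT', h₁, h₂⟩ := exists_present_slope_between d v ε (hθ hkk') (hdom k) (hdom k') (T i) (hT i) (hin i) (hout i)
    have hs : TropicalCensus.slope d x = h i := slope_hybrid d (p k) (p k') x (T i) hxT hxT'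
    refine Finset.mem_filter.mpr ⟨?_, ?_, ?_⟩
    · rw [← hs]; exact slope_mem_slopeSet d x
    · rw [← hs]; exact h₁
    · rw [← hs]; exact h₂
  calc r = (univ : Finset (Fin r)).card := by rw [Finset.card_univ, Fintype.card_fin]
    _ = ((univ : Finset (Fin r)).image h).card := (Finset.card_image_of_injective _ hmono.injective).symm
    _ ≤ _ := Finset.card_le_card fun s hs => by
        obtain ⟨i, -, rfl⟩ := Finset.mem_image.mp hs
        exact hmem i

/-! ## 3. The orbit count law for chains exhausting the slope budget -/

/-- **ORBIT COUNT LAW.**  Along a dominant chain exhausting the slope budget (`#slopeSet m d ≤ n + 1`; e.g. counting-tight), a nested separating family of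
invariant blocks for the pair `(p_k, p_k')` has at most `k' − k − 1` members: between two terms at distance `D` at most `D` orbits change.
[this cell] -/
theorem nested_blocks_le_dist (hθ : StrictMono θ) (hdom : ∀ k, IsDominant d v ε (θ k) (p k))
    (hne : ∀ k : Fin n, p k.castSucc ≠ p k.succ) (htight : (slopeSet m d).card ≤ n + 1)
    {k k' : Fin (n + 1)} (hkk' : k < k') {r : ℕ} (T : Fin r → Finset (Fin m))
    (hT : ∀ i, ∀ b, ((p k).1⁻¹ * (p k').1) b ∈ T i ↔ b ∈ T i)
    (hin : ∀ i, ∃ b ∈ T i, (p k).1 b ≠ (p k').1 b ∨ (p k).2 b ≠ (p k').2 b)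
    (hout : ∀ i, ∃ b ∉ T i, (p k).1 b ≠ (p k').1 b ∨ (p k).2 b ≠ (p k').2 b)
    (hnest : ∀ i j : Fin r, i < j → T i ⊆ T j ∧ ∃ b ∈ T j \ T i, (p k).1 b ≠ (p k').1 b ∨ (p k).2 b ≠ (p k').2 b) :
    r ≤ (k' : ℕ) - k - 1 := by
  classical
  have hsm := slope_strictMono d v ε θ p hθ hdom hne
  -- each hybrid slope is the slope of a chain term strictly between `k` and `k'`
  have hidx : ∀ i : Fin r, ∃ j : Fin (n + 1), k < j ∧ j < k' ∧
      TropicalCensus.slope d (p j) = ∑ b ∈ T i, (d ((p k').2 b) : ℤ) + ∑ b ∈ (T i)ᶜ, (d ((p k).2 b) : ℤ) :=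
    fun i => exists_between_of_split d v ε θ p hθ hdom hne htight hkk' (T i) (hT i) (hin i) (hout i)
  choose idx hk hk' hslope using hidx
  have hmono : StrictMono idx := by
    intro i j hij
    obtain ⟨hsub, hch⟩ := hnest i j hij
    have := hybridSlope_lt_of_subset d v ε (hθ hkk') (hdom k) (hdom k') hsub (hT i) (hT j) hch
    rw [← hslope i, ← hslope j] at this
    exact hsm.lt_iff_lt.mp this
  have hsub : (univ : Finset (Fin r)).image idx ⊆ Finset.Ioo k k' := fun j hj => by
    obtain ⟨i, -, rfl⟩ := Finset.mem_image.mp hj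
    exact Finset.mem_Ioo.mpr ⟨hk i, hk' i⟩
  calc r = (univ : Finset (Fin r)).card := by rw [Finset.card_univ, Fintype.card_fin]
    _ = ((univ : Finset (Fin r)).image idx).card := (Finset.card_image_of_injective _ hmono.injective).symm
    _ ≤ (Finset.Ioo k k').card := Finset.card_le_card hsub
    _ = (k' : ℕ) - k - 1 := by rw [Fin.card_Ioo]

/-- **orbit count law, census form** (counting-tight sign-alternating chains). [this cell] -/
theorem nested_blocks_le_dist_of_multichoose_le (hθ : StrictMono θ) (hdom : ∀ k, IsDominant d v ε (θ k) (p k))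
    (halt : ∀ k : Fin n, termSign ε (p k.castSucc) * termSign ε (p k.succ) < 0) (htight : Nat.multichoose K m ≤ n + 1)
    {k k' : Fin (n + 1)} (hkk' : k < k') {r : ℕ} (T : Fin r → Finset (Fin m))
    (hT : ∀ i, ∀ b, ((p k).1⁻¹ * (p k').1) b ∈ T i ↔ b ∈ T i)
    (hin : ∀ i, ∃ b ∈ T i, (p k).1 b ≠ (p k').1 b ∨ (p k).2 b ≠ (p k').2 b)
    (hout : ∀ i, ∃ b ∉ T i, (p k).1 b ≠ (p k').1 b ∨ (p k).2 b ≠ (p k').2 b)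
    (hnest : ∀ i j : Fin r, i < j → T i ⊆ T j ∧ ∃ b ∈ T j \ T i, (p k).1 b ≠ (p k').1 b ∨ (p k).2 b ≠ (p k').2 b) :
    r ≤ (k' : ℕ) - k - 1 :=
  nested_blocks_le_dist d v ε θ p hθ hdom (ne_succ_of_alternating ε p halt) ((card_slopeSet_le_multichoose d).trans htight)
    hkk' T hT hin hout hnest

end Chain

end Summit.ValiantsHypothesis.ValiantsHypothesis.Theorems.KPlusLogSqLaw.LongRangeAtom
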